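import Summits.Parity.BatemanHorn.Theses.RoughValueTransport
import Literature.NumberTheory.Sieve.RoughCellDensity

/-!
# Line `omega-class-shape-split` — checked skeleton for crux `RoughValueLaw`
(item stmt-Parity-11390, route `RoughValueTransport`, sub-problem `BatemanHorn`; crux-plan round 1,
planner-cruxplan-stmt-Parity-11390-omega-class-shape-sp-0, 2026-08-16)

Crux (by name, concluded by `RoughValueLaw_of` below, from `roughValueLaw_of_parts`):
`Summit.Parity.BatemanHorn.Theses.RoughValueTransport.RoughValueLaw` — for every Bateman–Horn system
`f = (f₁,…,f_k)` and every `ω` with Buchstab's three defining properties there is `A` with, for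
every depth `u > 2`, `Φ_f(x,u)·(log x)^k/x → A·(u ω(u))^k`, where
`Φ_f(x,u) = #{1 ≤ n ≤ x : ∀ i, fᵢ(n) > 0 and fᵢ(n) has no prime factor < x^{deg fᵢ/u}}`.

## The line (idea card `Ideas/omega-class-shape-split.md`; triage TRIAGE-r1-{1,2,3}.md: pass, pass, fail)

Sort the jointly rough `n` counted by `Φ_f(x,u)` by the vector of `Ω`-values
`r⃗ = (Ω(fᵢ(n)))ᵢ` — the Ω-CELLS `N_{f,r⃗}(x,u)` (`cellCount`).  The Hardy–Littlewood / Bateman–Horn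
random model, coordinate by coordinate, predicts `N_{f,r⃗}(x,u) ∼ A·∏ᵢ I_{rᵢ}(u)·x/(log x)^k` with
`A = C(f)/∏ deg fᵢ` and Buchstab–Alladi's cell densities `I_j(u)` (the tree's `roughCellDensity`:
`I₁ = 1`, `I₂(u) = log(u−1)`, `I_{j+2}(u) = ∫₁^{u−1} I_{j+1}(t) dt/t`, `Σ_j I_j(u) = u ω(u)` =
`sum_roughCellDensity_eq_mul_buchstabOmega`).  A Liouville tilt by a character
`χ_S(n) = ∏_{i∈S} λ(fᵢ(n))` (the `f`-analogue of the witnesses behind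
`Literature.Barriers.Parity.SelbergParityBarrier`) multiplies the cell `r⃗` by a factor that depends
only on the PARITY VECTOR `r⃗ mod 2`.  Hence the model splits into

* `stub_cellShape` — the PARITY-BLIND part (card "(I)", all cells, all depths, all systems): there
  are `2^k` amplitude functions `B_ε(x)`, one per parity vector `ε`, with
  `N_{f,r⃗}(x,u)(log x)^k/x = B_{r⃗ mod 2}(x)·∏ᵢ I_{rᵢ}(u) + o(1)` — invariant under every tilt;
* `stub_paritySignature` — the `2^k − 1` PARITY SCALARS (card "(II)"), in the intrinsic avatar asked
  for by triage r1-2: at the single depth `u = 3` the parity classes are in Hardy–Littlewood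
  proportion (`k = 1`: balanced semiprime values `= log 2 ×` prime values `+ o(x/log x)`);
* `stub_roughDecomposition` (provable now) — `Φ_f(x,u) = Σ_{r⃗ ∈ [1,⌊u⌋]^k} N_{f,r⃗}(x,u) + O(1)`
  (`Ω(fᵢ(n)) ≤ ⌊u⌋` on rough values; the `u < 3` case is cdisprove's `eventually_cardFactors_le_two`);
* `stub_amplitudeAnchor` (provable now) — the two-sided fundamental lemma along `f` plus
  `ω → e^{−γ}` pin ANY amplitude of a Buchstab-shaped rough-value profile to `A = C(f)/∏ deg fᵢ`
  (the "`∃A` and existence of the limit are OUTPUT" service of cards increment-anchoring /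
  scale-free-normal-form, stated once, multiplicatively, with NO rate — triage sharpenings on the
  `FLTwoSided` band honoured);
* `stub_buchstabUnique` (provable now) — the crux's inline predicate has the single solution
  `buchstabOmega` on `(2, ∞)` (refuter evidence `OmegaUnique.lean: buchstab_predicate_unique`).

Composition (`roughValueLaw_of_parts`, real proof): cells ⟹ parity classes at depth 3 ⟹ all
`B_ε` asymptotically equal (`stub_paritySignature`, `classWeight ε > 0`) ⟹
`Φ_f(x,u)(log x)^k/x = B₀(x)·(u ω(u))^k + o(1)` (Buchstab's cell identity, `Finset.sum_pow'`) ⟹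
`B₀ → A` (`stub_amplitudeAnchor`) ⟹ the crux at `ω = buchstabOmega` ⟹ the crux (`stub_buchstabUnique`).

HONESTY (triage r1-3 objection (iv), "the Transfer goes UP"): it does, and by necessity — the crux
constrains only the SUM over cells, whose tilt-saturation carries no cell-wise information, so any
Ω-class statement is stronger than its share of the crux.  The four stubs other than
`stub_buchstabUnique` prove, for every system, the Hardy–Littlewood model modulo parity amplitudes
and then the amplitudes: in particular the all-prime cell `r⃗ = (1,…,1)` gives
`P_f(x)(log x)^k/x → C(f)/∏ deg fᵢ` — Bateman–Horn for `f` itself (`primeCell_tendsto_of_parts`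
below records the cell form of this, proved).  The line is filed as what it is: a typed, refutable
normal form "RoughValueLaw = [HL model mod 2^k amplitudes] + [2^k − 1 scalars]" whose open stubs
are targets for refuters' numerics (finite-`x` models!) and whose provable stubs are the anchoring /
decomposition / uniqueness services every line of this crux needs.  `stub_cellShape` CONTAINS the
thinness of newborn cells (a cell is born at depth `u = max rᵢ`), i.e. the sibling crux
`BalancedSemiprimeLayer` coordinatewise (triage r1-3 `ShapeImpliesLayer.lean`): for degree `≤ 2`
that content is the provable target of line `Cruxes/BalancedSemiprimeLayer/Lines/smooth-modulus-twisted-hooley`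
(`CoordLayerThin`), for degree `≥ 3` it is the `FordMaynardLowLevel` residual both cruxes share.

## Reshapes c1 (third line lead prover-line-stmt-Parity-11390-c1-0, 2026-08-16; v2 → v5) — 7 registered stubs

* Every registered stub is stated over TREE vocabulary only (this file's `def`s `roughCount`,
  `cellCount`, `cellBox`, `modelDensity`, `parityVec`, `parityBox`, `parityClassSum`, `classWeight`,
  `bhAmplitude` UNFOLDED into `Finset.filter` counts, `Fintype.piFinset`, `roughCellDensity`,
  `batemanHornConst`, `buchstabOmega`, `ArithmeticFunction.cardFactors`), so that each lands as a
  pure-proof `--supports stmt-Parity-11390` file with no Defs file in between; the folded reading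
  forms are recovered definitionally (`roughDecomposition_of_stub`, `linearCells_of_stub`,
  `cellShapeGeneral_of_stub`, `thinCells_of_stub`, `paritySignatureGeneral_of_stub`,
  `amplitudeAnchor_of_stub`).  Registration is by `ledger workitem stub-add` (a `skeleton check`
  archives the other seats' skeleton-registered stubs on this shared crux item).
* LANDED (tree theorems of the same name and statement; the `sorry` placeholders below stand in for
  them so that this workfile elaborates on farm snapshots predating the landings; the hand-back
  variant imports them instead): `stub_buchstabUnique` (p98624,
  `Theorems/RoughValueTransportRoughValueLawBuchstabUnique.lean` — = lead 0's
  `OmegaFacts.eq_buchstabOmega`), `stub_roughDecomposition` (p100627, `…RoughDecomposition.lean`,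
  `K = Σ deg fᵢ`), `stub_amplitudeAnchor` (p102871, `…AmplitudeAnchor.lean`, from lead 0's landed
  `IncrementAnchoring.sieveAnchor_of_parts stub_sieveBand stub_mertensAlongSystem` +
  `harman2007_buchstabOmega_tendsto_holds`), `stub_thinCells` (p105512, `…ThinCells.lean`; p104779 was
  lost to a gate restart), `stub_linearCells` (p105513, `…LinearCells.lean`, Alladi's Ω-cell theorem in the
  progression `b mod a` via the tree's `exists_abs_roughCell_sub_main_le` + `RoughCellsAP.exists_abs_cellClassDisc_le`).
* Provable SECTORS split off at the skeleton level (as lead 0 split `stub_linearRoughValueLaw` off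
  the crux): `stub_linearCells` — for ONE LINEAR polynomial `aX + b` every Ω-cell has Alladi's shape
  with the constant Hardy–Littlewood amplitude `a/φ(a)` (provable now from the tree's
  `exists_abs_roughCell_sub_main_le` + `RoughCellsAP.exists_abs_cellClassDisc_le`; LANDED p105513);
  `stub_thinCells` — overshoot cells (`∃ i, u < rᵢ`: empty eventually) and monic coordinates at depth
  `u ≤ rᵢ` (at most `H + 1` members) satisfy the cell-shape conclusion for every amplitude (PROVED).
  The OPEN stubs are restricted to the complement: `stub_cellShapeGeneral` (non-thin cells of systems
  outside the linear sector) and `stub_paritySignatureGeneral` (outside the linear sector); the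
  former statements for ALL systems and cells are THEOREMS of this file (`cellShape_of_stubs`,
  `paritySignature_of_stubs`).
* VERDICT prepared (`Lines/omega-class-shape-split.dead.md`): the two open stubs are Hardy–Littlewood
  strength and STRICTLY STRONGER than the crux (`primeCell_tendsto_of_parts`; triage r1-3), so the
  line ends `line-dead` with its services landed; no cell-wise weakening inside the composition idea
  is crux-equivalent (the only crux-equivalent weakening, an amplitude-free Buchstab shape of the SUM
  over cells, is line increment-anchoring's landed normal form `roughValueLaw_iff_ratioLaws`).
* Disproof.lean (cycle-1 final, 05:08Z, re-read at every reshape): no `-- Targets` section, nothing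
  under `Theorems/RoughValueLaw/Negative/`; `eventually_cardFactors_le_two` / `abs_eval_le` are the
  `u < 3` case / the height bound behind `stub_roughDecomposition` and `stub_thinCells` (adapted with
  attribution in their `--supports` files — a Cruxes workfile is not importable under Theorems).

Disproof used (`Disproof.lean` of refuter-cdisprove-stmt-Parity-11390-0, cited through its evidence
notes — the file body is not mounted in planner jails): `_false_without_nonAssociated` /
`_false_without_irreducible` are honoured at `stub_cellShape` + `stub_amplitudeAnchor` (the model
amplitude `C(f)/∏deg` with exponent `k` is right only for pairwise non-associated irreducible
coordinates: `(X, X)` has `Φ ≍ x/log x`, not `x/(log x)²`); `_false_without_omegaInit/omegaDDE` at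
`stub_buchstabUnique` (both clauses are used by the method of steps; continuity is NOT used —
`continuousOn_of_init_of_dde`); `not_roughValueLawUniform` — no stub asks uniformity in `u`
(every `o(1)` is pointwise in `(r⃗, u)`); `eventually_cardFactors_le_two` = `stub_roughDecomposition`
for `u < 3`; rungs `tendsto_ratio_X`, `conclusion_twoXAddOne` — the unit tests of `stub_cellShape` /
`stub_paritySignature` for `f = X` are Alladi's theorem and Landau's `π₂`-asymptotic (true).
No `Theorems/RoughValueLaw/Negative/` lemma has landed (nothing to import).
-/

noncomputable section

namespace Summit.Parity.BatemanHorn.Cruxes.RoughValueLaw.OmegaClassShapeSplit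

open Filter Finset Polynomial
open scoped BigOperators Topology ArithmeticFunction.Omega
open Literature.NumberTheory.Sieve
open Summit.Parity.BatemanHorn.Theses.RoughValueTransport (RoughValueLaw)

/-! ### Objects of the line -/

/-- `Φ_f(x,u)`: the crux's jointly-rough count, VERBATIM the finset of
`RoughValueTransport.RoughValueLaw` (coordinate `i` sifted by the primes `< x^{deg fᵢ/u}`). [folklore] -/
def roughCount {k : ℕ} (f : Fin k → ℤ[X]) (u : ℝ) (x : ℕ) : ℕ :=
  ((Icc 1 x).filter (fun n : ℕ => ∀ i, 0 < (f i).eval (n : ℤ) ∧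
    ∀ p ∈ range ⌈(x : ℝ) ^ (((f i).natDegree : ℝ) / u)⌉₊,
      p.Prime → ¬ ((p : ℤ) ∣ (f i).eval (n : ℤ)))).card

/-- The Ω-CELL `N_{f,r⃗}(x,u)`: the `n` counted by `Φ_f(x,u)` whose values have exactly `rᵢ` prime
factors (with multiplicity) in coordinate `i`, `Ω(fᵢ(n)) = rᵢ` (`Ω` = Mathlib's
`ArithmeticFunction.cardFactors`, applied to the positive integer `fᵢ(n)`). The cells partition the
rough set by the Ω-vector. [folklore] -/
def cellCount {k : ℕ} (f : Fin k → ℤ[X]) (r : Fin k → ℕ) (u : ℝ) (x : ℕ) : ℕ :=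
  ((Icc 1 x).filter (fun n : ℕ => (∀ i, 0 < (f i).eval (n : ℤ) ∧
    ∀ p ∈ range ⌈(x : ℝ) ^ (((f i).natDegree : ℝ) / u)⌉₊,
      p.Prime → ¬ ((p : ℤ) ∣ (f i).eval (n : ℤ))) ∧
    ∀ i, Ω ((f i).eval (n : ℤ)).toNat = r i)).card

/-- The box of Ω-vectors `[1, R]^k` (at depth `u` only the cells with `1 ≤ rᵢ ≤ ⌊u⌋` are occupied,
up to `O(1)` values `fᵢ(n) = 1`: `stub_roughDecomposition`). [folklore] -/
def cellBox (k R : ℕ) : Finset (Fin k → ℕ) :=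
  Fintype.piFinset fun _ : Fin k => Icc 1 R

/-- The MODEL DENSITY of the cell `r⃗` at depth `u`: `∏ᵢ I_{rᵢ}(u)` (Buchstab–Alladi cell densities,
tree `roughCellDensity`; the Hardy–Littlewood model factorises over the coordinates, each sifted to
the same value depth `u`). [folklore] -/
def modelDensity {k : ℕ} (r : Fin k → ℕ) (u : ℝ) : ℝ :=
  ∏ i, roughCellDensity (r i) u

/-- The parity vector `r⃗ mod 2` of an Ω-vector. [folklore] -/
def parityVec {k : ℕ} (r : Fin k → ℕ) : Fin k → ℕ := fun i => r i % 2

/-- The Ω-vectors of parity `ε` occupied at depth `3`: `rᵢ ∈ {1,2,3}`, `rᵢ ≡ εᵢ (mod 2)`. [folklore] -/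
def parityBox {k : ℕ} (ε : Fin k → ℕ) : Finset (Fin k → ℕ) :=
  Fintype.piFinset fun i => (Icc 1 3).filter (fun r => r % 2 = ε i)

/-- `Φ_{f,ε}(x,3)`: the PARITY CLASS `ε` of the jointly `x^{deg fᵢ/3}`-rough values — the `n` with
`Ω(fᵢ(n)) ≡ εᵢ (mod 2)` for every `i` — written as the sum of its cells at depth `3`
(`rᵢ ∈ {1,2,3}`; it IS the class up to the `O(1)` values `fᵢ(n) = 1`, by `stub_roughDecomposition`).
For `k = 1`: `ε = 1` ↦ prime values (+ the `o(x/log x)` cell `Ω = 3`), `ε = 0` ↦ balanced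
semiprime values `fᵢ(n) = pq`, `p, q ≥ x^{deg/3}`. [folklore] -/
def parityClassSum {k : ℕ} (f : Fin k → ℤ[X]) (ε : Fin k → ℕ) (x : ℕ) : ℕ :=
  ∑ r ∈ parityBox ε, cellCount f r 3 x

/-- The MODEL WEIGHT of the parity class `ε` at depth `3`: `∏ᵢ J(εᵢ)` with `J(0) = I₂(3) = log 2`
(even cells alive at depth 3: `Ω = 2`) and `J(1) = I₁(3) + I₃(3) = 1 + 0 = 1` (odd cells: primes;
`I₃(3) = 0`). [folklore] -/
def classWeight {k : ℕ} (ε : Fin k → ℕ) : ℝ :=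
  ∏ i, (if ε i = 0 then Real.log 2 else 1)

/-- The expected amplitude `A = C(f)/∏ᵢ deg fᵢ` (`C(f) = batemanHornConst f`). [folklore] -/
def bhAmplitude {k : ℕ} (f : Fin k → ℤ[X]) : ℝ :=
  batemanHornConst f / ∏ i, ((f i).natDegree : ℝ)

/-! ### The registered stubs (`sorry` lives ONLY here) -/

/-- **stub_roughDecomposition** — LANDED (p100627, Theorems/RoughValueTransportRoughValueLawRoughDecomposition.lean): this `sorry` is a placeholder for the tree theorem of the
same name and statement (imported in place of it when the final skeleton lands; kept here so that the
workfile elaborates against farm snapshots that predate the landing). -/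
theorem stub_roughDecomposition :
    ∀ (k : ℕ) (f : Fin k → ℤ[X]), IsBatemanHornSystem f → ∀ u : ℝ, 2 < u → ∃ K : ℝ, ∀ᶠ x : ℕ in
      atTop, |(((Icc 1 x).filter (fun n : ℕ => ∀ i, 0 < (f i).eval (n : ℤ) ∧ ∀ p ∈ range ⌈(x :
      ℝ) ^ (((f i).natDegree : ℝ) / u)⌉₊, p.Prime → ¬ ((p : ℤ) ∣ (f i).eval (n : ℤ)))).card : ℝ)
      - ∑ r ∈ Fintype.piFinset (fun _ : Fin k => Icc 1 ⌊u⌋₊), (((Icc 1 x).filter (fun n : ℕ =>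
      (∀ i, 0 < (f i).eval (n : ℤ) ∧ ∀ p ∈ range ⌈(x : ℝ) ^ (((f i).natDegree : ℝ) / u)⌉₊,
      p.Prime → ¬ ((p : ℤ) ∣ (f i).eval (n : ℤ))) ∧ ∀ i, ArithmeticFunction.cardFactors ((f
      i).eval (n : ℤ)).toNat = r i)).card : ℝ)| ≤ K := by
  sorry

/-- **stub_linearCells** (reshape c1, 2026-08-16; LANDED p105513 — `sorry` below is the placeholder for the tree
theorem of the same name; size M/L — the provable SECTOR of
the two open stubs, split off at the skeleton level exactly as lead 0 split `stub_linearRoughValueLaw`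
off the crux).  For a Bateman–Horn system of ONE LINEAR polynomial `f₀ = aX + b` (`a ≥ 1`,
`gcd(a,b) = 1` by `hasNoFixedPrimeDivisor`) every Ω-cell has the Alladi shape with the Hardy–Littlewood
amplitude: `N_{f,j}(x,u)·(log x)/x → (a/φ(a))·I_j(u)` for every `j ≥ 1`, `u > 2`, i.e. with the CONSTANT
amplitude `bhAmplitude f = C(aX+b)/1 = a/φ(a)` (lead 0's `LinearRoughValueLaw.const_of_linear`).
Proof plan: the values `m = an + b`, `1 ≤ n ≤ x`, are the members `≡ b (mod a)` of `(b, ax+b]`; sifted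
by the primes `< ⌈x^{1/u}⌉` and sorted by `Ω = j` they are the tree's rough Ω-cells in a reduced class:
`exists_abs_cellClassDisc_le` (cells equidistributed over the `φ(a)` reduced classes, rate `X/log² Y`,
needs `a < Y = ⌈x^{1/u}⌉` — eventually) + `exists_abs_roughCell_sub_main_le` (Alladi:
`#{b ∈ roughIcc ⌈Y⌉ ⌊X⌋ : Ω b = j} = X I_j(log X/log Y)/log X − [j = 1] Y/log Y + O(X/log² Y)`) with
`X = ax + b`, `Y = ⌈x^{1/u}⌉` (`log X/log Y → u`; `I_j` continuous on `[1,∞)` for `j ≥ 2`,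
`continuousOn_roughCellDensity`; `I_1 ≡ 1` there), minus the `O(Y)` members `m ≤ Y` and the `O(1)`
boundary terms; the AP/positivity bookkeeping (`b < 0`, `b ≥ a`) as in
`Theorems/RoughValueTransportRoughValueLawLinearRoughValueLaw.lean` (`tendsto_card_filter_linear`).
Stated with `Real.log x ^ 1` so that it is literally the `k = 1` instance of the cell-shape form. -/
theorem stub_linearCells :
    ∀ (f : Fin 1 → ℤ[X]), IsBatemanHornSystem f → (f 0).natDegree = 1 → ∀ r : Fin 1 → ℕ, (∀ i, 1
      ≤ r i) → ∀ u : ℝ, 2 < u → Tendsto (fun x : ℕ => (((Icc 1 x).filter (fun n : ℕ => (∀ i, 0 <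
      (f i).eval (n : ℤ) ∧ ∀ p ∈ range ⌈(x : ℝ) ^ (((f i).natDegree : ℝ) / u)⌉₊, p.Prime → ¬ ((p
      : ℤ) ∣ (f i).eval (n : ℤ))) ∧ ∀ i, ArithmeticFunction.cardFactors ((f i).eval (n :
      ℤ)).toNat = r i)).card : ℝ) * Real.log x ^ 1 / x - batemanHornConst f / (∏ i, ((f
      i).natDegree : ℝ)) * ∏ i, roughCellDensity (r i) u) atTop (𝓝 0) := by
  sorry

/-- **stub_cellShapeGeneral** (OPEN — the line's lever, card "(I)", OUTSIDE the linear sector and for the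
cells INSIDE the box `rᵢ ≤ u`, `rᵢ < u` at MONIC coordinates, only (reshape v4/v5: the thin cells — overshoot
`∃ i, u < rᵢ`, or monic coordinate with `u ≤ rᵢ` — are `stub_thinCells`, PROVED); the
hypothesis `¬ (k = 1 ∧ ∀ i, deg fᵢ = 1)` excludes exactly the one-linear-polynomial systems of
`stub_linearCells`; `k = 0`, `k = 1` with `deg ≥ 2`, and all `k ≥ 2` are included).  For every such Bateman–Horn system there
are `2^k` amplitude functions `B_ε : ℕ → ℝ`, indexed by parity vectors `ε ∈ {0,1}^k`, such that every
Ω-cell follows the Buchstab–Alladi SHAPE of its coordinates' cell densities with the amplitude of its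
parity class: `N_{f,r⃗}(x,u)·(log x)^k/x − B_{r⃗ mod 2}(x)·∏ᵢ I_{rᵢ}(u) → 0` for every `r⃗ ≥ 1` and
every `u > 2` (pointwise in `(r⃗, u)`, cf. `not_roughValueLawUniform`).  Invariant under every
Liouville tilt `∏(1 + δ_S χ_S)` (they rescale `B_ε` only), hence NOT refutable by Selberg's witnesses;
for GENERAL sequences of level `< 1` it does not follow from Type-I data
(`Literature.Barriers.Parity.FordFixedLevelBarrier`).  Expected truth: the Hardy–Littlewood model with
`B_ε → C(f)/∏deg fᵢ`.  CONTENT (line card §Stubs): (a) cell INCREMENT shapes in `u` (crux-strength);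
(b) thinness of NEWBORN cells near `u = max rᵢ` (= sibling crux `BalancedSemiprimeLayer`
coordinatewise; triage r1-3 `ShapeImpliesLayer.lean`); (c) same-parity cross-cell anchors
(`#{f(n) = P₃ rough} ∼ I₃(u)·#{f(n) prime}`).  STATUS: open for every system outside the linear
sector (for `k ≥ 2` with linear coordinates it contains the Hardy–Littlewood k-tuple SHAPE for almost
primes; for `deg ≥ 2` Bombieri's asymptotic sieve does not apply: level `1/deg < 1` in the value
scale).  For `rᵢ > u` both sides vanish eventually (trivially true there). -/
theorem stub_cellShapeGeneral :
    ∀ (k : ℕ) (f : Fin k → ℤ[X]), IsBatemanHornSystem f → ¬ (k = 1 ∧ ∀ i, (f i).natDegree = 1) →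
      ∃ B : (Fin k → ℕ) → ℕ → ℝ, ∀ r : Fin k → ℕ, (∀ i, 1 ≤ r i) → ∀ u : ℝ, 2 < u → (∀ i, (r i :
      ℝ) ≤ u) → (∀ i, (f i).Monic → (r i : ℝ) < u) → Tendsto (fun x : ℕ => (((Icc 1 x).filter
      (fun n : ℕ => (∀ i, 0 < (f i).eval (n : ℤ) ∧ ∀ p ∈ range ⌈(x : ℝ) ^ (((f i).natDegree : ℝ)
      / u)⌉₊, p.Prime → ¬ ((p : ℤ) ∣ (f i).eval (n : ℤ))) ∧ ∀ i, ArithmeticFunction.cardFactors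
      ((f i).eval (n : ℤ)).toNat = r i)).card : ℝ) * Real.log x ^ k / x - B (fun i => r i % 2) x
      * ∏ i, roughCellDensity (r i) u) atTop (𝓝 0) := by
  sorry

/-- **stub_thinCells** (reshape v5; LANDED p105512 — the recon worker's audit lemmas for `stub_cellShapeGeneral`;
`sorry` below is the placeholder for the tree theorem of the same name).  THIN cells: an overshoot coordinate `u < rᵢ` (the cell is EMPTY
eventually: every prime factor of `fᵢ(n)` is `≥ ⌈x^{dᵢ/u}⌉` while `fᵢ(n) ≪ x^{dᵢ}`, so `Ω ≤ ⌊u⌋`) or a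
MONIC coordinate at depth `u ≤ rᵢ` (then `fᵢ(n) ≥ x^{dᵢ}` forces `x − H ≤ n ≤ x`: at most `H + 1`
members for every `x`; in particular the TOP cells `rᵢ = u ∈ ℕ` of a monic coordinate are `O(1)`); in
both cases the model density `∏ I_{rᵢ}(u)` is `0` (`roughCellDensity_of_lt/_of_le`), so the
cell-shape conclusion holds there for EVERY amplitude table `B`.  Stated for all systems. -/
theorem stub_thinCells :
    ∀ (k : ℕ) (f : Fin k → ℤ[X]), IsBatemanHornSystem f → ∀ B : (Fin k → ℕ) → ℕ → ℝ, ∀ r : Fin k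
      → ℕ, ∀ u : ℝ, 2 < u → ((∃ i, u < (r i : ℝ)) ∨ (∃ i, (f i).Monic ∧ u ≤ (r i : ℝ))) →
      Tendsto (fun x : ℕ => (((Icc 1 x).filter (fun n : ℕ => (∀ i, 0 < (f i).eval (n : ℤ) ∧ ∀ p
      ∈ range ⌈(x : ℝ) ^ (((f i).natDegree : ℝ) / u)⌉₊, p.Prime → ¬ ((p : ℤ) ∣ (f i).eval (n :
      ℤ))) ∧ ∀ i, ArithmeticFunction.cardFactors ((f i).eval (n : ℤ)).toNat = r i)).card : ℝ) *
      Real.log x ^ k / x - B (fun i => r i % 2) x * ∏ i, roughCellDensity (r i) u) atTop (𝓝 0) := by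
  sorry

/-- **stub_paritySignatureGeneral** (OPEN — card "(II)": the `2^k − 1` parity scalars OUTSIDE the
linear sector (same exclusion hypothesis as `stub_cellShapeGeneral`; the linear sector follows from
`stub_linearCells`, `paritySignature_of_stubs`); `Literature.Barriers.Parity.SelbergParityBarrier`
APPLIES in full and is not evaded — this is where non-sieve input must enter).  Intrinsic avatar at ONE
depth, `u = 3`: the parity classes of the jointly `x^{deg fᵢ/3}`-rough values are in Hardy–Littlewood
proportion, `Φ_{f,ε}(x,3) : Φ_{f,ε'}(x,3) → W(ε) : W(ε')` with `W(ε) = (log 2)^{#{i : εᵢ = 0}}`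
(`classWeight`), stated cross-multiplied.  `k = 1`, `deg f = 2`:
`#{n ≤ x : f(n) = pq, p, q ≥ x^{2/3}} = log 2 · #{n ≤ x : f(n) prime} + o(x/log x)` — open even in its
weakest dense form for one quadratic (Teräväinen arXiv:2010.07924 Problem 3.1); with
`stub_cellShapeGeneral` + `Φ_f(x,3) ≫ x/(log x)^k` it yields `≫ x/(log x)^k` simultaneous prime values.
NUMERICS WARNING (all three triagers): converges like `1/log x`; kill tests must compare with the
finite-`x` Hardy–Littlewood model, never with the limit. -/
theorem stub_paritySignatureGeneral :
    ∀ (k : ℕ) (f : Fin k → ℤ[X]), IsBatemanHornSystem f → ¬ (k = 1 ∧ ∀ i, (f i).natDegree = 1) →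
      ∀ ε ε' : Fin k → ℕ, (∀ i, ε i ≤ 1) → (∀ i, ε' i ≤ 1) → Tendsto (fun x : ℕ => ((∑ r ∈
      Fintype.piFinset (fun i => (Icc 1 3).filter (fun j : ℕ => j % 2 = ε i)), (((Icc 1
      x).filter (fun n : ℕ => (∀ i, 0 < (f i).eval (n : ℤ) ∧ ∀ p ∈ range ⌈(x : ℝ) ^ (((f
      i).natDegree : ℝ) / 3)⌉₊, p.Prime → ¬ ((p : ℤ) ∣ (f i).eval (n : ℤ))) ∧ ∀ i,
      ArithmeticFunction.cardFactors ((f i).eval (n : ℤ)).toNat = r i)).card : ℝ)) * (∏ i, (if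
      ε' i = 0 then Real.log 2 else (1 : ℝ))) - (∑ r ∈ Fintype.piFinset (fun i => (Icc 1
      3).filter (fun j : ℕ => j % 2 = ε' i)), (((Icc 1 x).filter (fun n : ℕ => (∀ i, 0 < (f
      i).eval (n : ℤ) ∧ ∀ p ∈ range ⌈(x : ℝ) ^ (((f i).natDegree : ℝ) / 3)⌉₊, p.Prime → ¬ ((p :
      ℤ) ∣ (f i).eval (n : ℤ))) ∧ ∀ i, ArithmeticFunction.cardFactors ((f i).eval (n : ℤ)).toNat
      = r i)).card : ℝ)) * (∏ i, (if ε i = 0 then Real.log 2 else (1 : ℝ)))) * Real.log x ^ k /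
      x) atTop (𝓝 0) := by
  sorry

/-- **stub_amplitudeAnchor** (LANDED p102871 — `sorry` below is the placeholder for the tree theorem of the same
name; the anchoring service, stated ONCE for every
line of this crux, in multiplicative form and WITHOUT a rate).  If a function `B₀(x)` is an
amplitude of the rough-value profile in Buchstab shape, `Φ_f(x,u)(log x)^k/x = B₀(x)(uω(u))^k + o(1)`
for every `u > 2`, then `B₀(x) → C(f)/∏ deg fᵢ`.  Proof sketch: the two-sided fundamental lemma along
`f` (PROVED `SieveSequence.fundamental_lemma_uniform_holds`, prime-dependent sifting sets
`Ω_p = roots of ∏_{i : zᵢ > p} fᵢ`, level `x^{1−ε}`, remainders `≤ ω_f(d)`) and Mertens along the nested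
sub-systems (PROVED `IsBatemanHornSystem.hasBatemanHornConst_holds`,
`tendsto_log_mul_prod_one_sub_inv_nat`) give, for every `v ≥ v₀` and eventually in `x`,
`|Φ_f(x,v)(log x)^k/x − A e^{−kγ} v^k| ≤ θ(v) v^k` with SOME `θ(v) → 0` (the tree FL yields
`θ(v) ≍ e^{−(1−ε)v/deg_max}` — any `θ → 0` suffices; triage r1-1/2/3 sharpenings on the band); hence
`|B₀(x) ω(v)^k − A e^{−kγ}| ≤ θ(v) + o(1)`, and `ω(v) → e^{−γ}` (PROVED
`harman2007_buchstabOmega_tendsto_holds`), `ω ≥ 1/2` (`half_le_buchstabOmega`) squeeze `B₀ → A`.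
`k = 0`: `Φ = x`, `B₀ → 1 = C(∅)/1`.  Same proof core as the route's support item `SieveCalibration`
(stmt-Parity-11391) and as cards increment-anchoring (`anchoring` + `FLTwoSided`) /
scale-free-normal-form (`roughValueLaw_of_ratioLaw`) — prove once, here. -/
theorem stub_amplitudeAnchor :
    ∀ (k : ℕ) (f : Fin k → ℤ[X]), IsBatemanHornSystem f → ∀ B₀ : ℕ → ℝ, (∀ u : ℝ, 2 < u →
      Tendsto (fun x : ℕ => (((Icc 1 x).filter (fun n : ℕ => ∀ i, 0 < (f i).eval (n : ℤ) ∧ ∀ p ∈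
      range ⌈(x : ℝ) ^ (((f i).natDegree : ℝ) / u)⌉₊, p.Prime → ¬ ((p : ℤ) ∣ (f i).eval (n :
      ℤ)))).card : ℝ) * Real.log x ^ k / x - B₀ x * (u * buchstabOmega u) ^ k) atTop (𝓝 0)) →
      Tendsto B₀ atTop (𝓝 (batemanHornConst f / (∏ i, ((f i).natDegree : ℝ)))) := by
  sorry

/-- **stub_buchstabUnique** — LANDED (p98624, Theorems/RoughValueTransportRoughValueLawBuchstabUnique.lean): this `sorry` is a placeholder for the tree theorem of the
same name and statement (imported in place of it when the final skeleton lands; kept here so that the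
workfile elaborates against farm snapshots that predate the landing). -/
theorem stub_buchstabUnique :
    ∀ ω : ℝ → ℝ, ((∀ u : ℝ, 1 ≤ u → u ≤ 2 → ω u = u⁻¹) ∧ ContinuousOn ω (Set.Ici 1) ∧ (∀ u : ℝ,
      2 < u → HasDerivAt (fun t : ℝ => t * ω t) (ω (u - 1)) u)) → ∀ u : ℝ, 2 < u → ω u =
      buchstabOmega u := by
  sorry

/-! ### Reshape c1: the registered stubs are stated over TREE vocabulary only (the line's `def`s
unfolded), so that each lands as a pure-proof `--supports` file; here are the definitional bridges
back to the line's reading vocabulary (`rfl`/`exact` by `δ`-unfolding). -/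

/-- Folded form of `stub_roughDecomposition`. [folklore] -/
theorem roughDecomposition_of_stub :
    ∀ (k : ℕ) (f : Fin k → ℤ[X]), IsBatemanHornSystem f → ∀ u : ℝ, 2 < u →
      ∃ K : ℝ, ∀ᶠ x : ℕ in atTop,
        |(roughCount f u x : ℝ) - ∑ r ∈ cellBox k ⌊u⌋₊, (cellCount f r u x : ℝ)| ≤ K :=
  stub_roughDecomposition

/-- Folded form of `stub_linearCells`. [folklore] -/
theorem linearCells_of_stub :
    ∀ (f : Fin 1 → ℤ[X]), IsBatemanHornSystem f → (f 0).natDegree = 1 →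
      ∀ r : Fin 1 → ℕ, (∀ i, 1 ≤ r i) → ∀ u : ℝ, 2 < u →
        Tendsto (fun x : ℕ => (cellCount f r u x : ℝ) * Real.log x ^ 1 / x
          - bhAmplitude f * modelDensity r u) atTop (𝓝 0) :=
  stub_linearCells

/-- Folded form of `stub_cellShapeGeneral` (v5: non-thin cells). [folklore] -/
theorem cellShapeGeneral_of_stub :
    ∀ (k : ℕ) (f : Fin k → ℤ[X]), IsBatemanHornSystem f → ¬ (k = 1 ∧ ∀ i, (f i).natDegree = 1) →
      ∃ B : (Fin k → ℕ) → ℕ → ℝ, ∀ r : Fin k → ℕ, (∀ i, 1 ≤ r i) → ∀ u : ℝ, 2 < u →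
        (∀ i, (r i : ℝ) ≤ u) → (∀ i, (f i).Monic → (r i : ℝ) < u) →
        Tendsto (fun x : ℕ => (cellCount f r u x : ℝ) * Real.log x ^ k / x
          - B (parityVec r) x * modelDensity r u) atTop (𝓝 0) :=
  stub_cellShapeGeneral

/-- Folded form of `stub_thinCells`. [folklore] -/
theorem thinCells_of_stub :
    ∀ (k : ℕ) (f : Fin k → ℤ[X]), IsBatemanHornSystem f → ∀ B : (Fin k → ℕ) → ℕ → ℝ,
      ∀ r : Fin k → ℕ, ∀ u : ℝ, 2 < u → ((∃ i, u < (r i : ℝ)) ∨ (∃ i, (f i).Monic ∧ u ≤ (r i : ℝ))) →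
        Tendsto (fun x : ℕ => (cellCount f r u x : ℝ) * Real.log x ^ k / x
          - B (parityVec r) x * modelDensity r u) atTop (𝓝 0) :=
  stub_thinCells

/-- Folded form of `stub_paritySignatureGeneral`. [folklore] -/
theorem paritySignatureGeneral_of_stub :
    ∀ (k : ℕ) (f : Fin k → ℤ[X]), IsBatemanHornSystem f → ¬ (k = 1 ∧ ∀ i, (f i).natDegree = 1) →
      ∀ ε ε' : Fin k → ℕ, (∀ i, ε i ≤ 1) → (∀ i, ε' i ≤ 1) →
        Tendsto (fun x : ℕ => ((parityClassSum f ε x : ℝ) * classWeight ε'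
          - (parityClassSum f ε' x : ℝ) * classWeight ε) * Real.log x ^ k / x) atTop (𝓝 0) := by
  intro k f hf hgen ε ε' hε hε'
  have h := stub_paritySignatureGeneral k f hf hgen ε ε' hε hε'
  refine h.congr' (Eventually.of_forall fun x => ?_)
  simp only [parityClassSum, parityBox, cellCount, classWeight, Nat.cast_sum]

/-- Folded form of `stub_amplitudeAnchor`. [folklore] -/
theorem amplitudeAnchor_of_stub :
    ∀ (k : ℕ) (f : Fin k → ℤ[X]), IsBatemanHornSystem f → ∀ B₀ : ℕ → ℝ,
      (∀ u : ℝ, 2 < u → Tendsto (fun x : ℕ => (roughCount f u x : ℝ) * Real.log x ^ k / x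
        - B₀ x * (u * buchstabOmega u) ^ k) atTop (𝓝 0)) →
      Tendsto B₀ atTop (𝓝 (bhAmplitude f)) :=
  stub_amplitudeAnchor

/-! ### Glue (proved): elementary limits -/

/-- `(log x)^k / x → 0` along `ℕ`. [folklore] -/
theorem tendsto_log_pow_div_self (k : ℕ) :
    Tendsto (fun x : ℕ => Real.log x ^ k / (x : ℝ)) atTop (𝓝 0) := by
  have h1 : Tendsto (fun x : ℝ => Real.log x ^ k / x) atTop (𝓝 0) := by
    simpa using Real.tendsto_pow_log_div_mul_add_atTop 1 0 k one_ne_zero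
  exact h1.comp tendsto_natCast_atTop_atTop

/-- From the decomposition stub: `Φ` and the sum of its cells agree to `o(x/(log x)^k)`. [folklore] -/
theorem tendsto_roughCount_sub_sum_cells {k : ℕ} (f : Fin k → ℤ[X]) (u : ℝ) (K : ℝ)
    (hK : ∀ᶠ x : ℕ in atTop,
      |(roughCount f u x : ℝ) - ∑ r ∈ cellBox k ⌊u⌋₊, (cellCount f r u x : ℝ)| ≤ K) :
    Tendsto (fun x : ℕ => (roughCount f u x : ℝ) * Real.log x ^ k / x
      - (∑ r ∈ cellBox k ⌊u⌋₊, (cellCount f r u x : ℝ)) * Real.log x ^ k / x) atTop (𝓝 0) := by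
  have h0 : Tendsto (fun x : ℕ => |K| * (Real.log x ^ k / (x : ℝ))) atTop (𝓝 0) := by
    simpa using (tendsto_log_pow_div_self k).const_mul |K|
  refine squeeze_zero_norm' ?_ h0
  filter_upwards [hK, eventually_gt_atTop 1] with x hx hx1
  have hx1' : (1 : ℝ) < x := by exact_mod_cast hx1
  have hxpos : (0 : ℝ) < x := by linarith
  have hL : 0 ≤ Real.log x ^ k / (x : ℝ) :=
    div_nonneg (pow_nonneg (Real.log_nonneg hx1'.le) k) hxpos.le
  have heq : (roughCount f u x : ℝ) * Real.log x ^ k / x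
      - (∑ r ∈ cellBox k ⌊u⌋₊, (cellCount f r u x : ℝ)) * Real.log x ^ k / x
      = ((roughCount f u x : ℝ) - ∑ r ∈ cellBox k ⌊u⌋₊, (cellCount f r u x : ℝ))
        * (Real.log x ^ k / x) := by ring
  rw [heq, Real.norm_eq_abs, abs_mul, abs_of_nonneg hL]
  exact mul_le_mul_of_nonneg_right (hx.trans (le_abs_self K)) hL

/-- From the cell-shape stub: the sum of the cells of the box is the `B`-weighted sum of the model
densities up to `o(1)`. [folklore] -/
theorem tendsto_sum_cells_sub_model {k : ℕ} (f : Fin k → ℤ[X]) (B : (Fin k → ℕ) → ℕ → ℝ)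
    (hB : ∀ r : Fin k → ℕ, (∀ i, 1 ≤ r i) → ∀ u : ℝ, 2 < u →
      Tendsto (fun x : ℕ => (cellCount f r u x : ℝ) * Real.log x ^ k / x
        - B (parityVec r) x * modelDensity r u) atTop (𝓝 0))
    (s : Finset (Fin k → ℕ)) (hs : ∀ r ∈ s, ∀ i, 1 ≤ r i) {u : ℝ} (hu : 2 < u) :
    Tendsto (fun x : ℕ => (∑ r ∈ s, (cellCount f r u x : ℝ)) * Real.log x ^ k / x
      - ∑ r ∈ s, B (parityVec r) x * modelDensity r u) atTop (𝓝 0) := by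
  have h := tendsto_finsetSum s (fun r hr => hB r (hs r hr) u hu)
  rw [sum_const_zero] at h
  refine h.congr' (Eventually.of_forall fun x => ?_)
  dsimp only
  rw [sum_sub_distrib, sum_mul, sum_div]

/-! ### Glue (proved): the model identities at depth `u` and at depth `3` -/

/-- `Σ_{1 ≤ j ≤ ⌊u⌋} I_j(u) = u ω(u)` for `u ≥ 1` (the tree's Buchstab cell identity, re-indexed
from `range` to `Icc 1 ⌊u⌋`). [folklore] -/
theorem sum_Icc_roughCellDensity {u : ℝ} (hu : 1 ≤ u) :
    ∑ j ∈ Icc 1 ⌊u⌋₊, roughCellDensity j u = u * buchstabOmega u := by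
  have hfl : 1 ≤ ⌊u⌋₊ := Nat.le_floor (by exact_mod_cast hu)
  obtain ⟨N, hN⟩ : ∃ N : ℕ, ⌊u⌋₊ = N + 1 := ⟨⌊u⌋₊ - 1, by omega⟩
  rw [hN]
  have h1 : ∑ j ∈ Icc 1 (N + 1), roughCellDensity j u
      = ∑ j ∈ range (N + 1), roughCellDensity (j + 1) u := by
    rw [← Finset.Ico_add_one_right_eq_Icc, Finset.sum_Ico_eq_sum_range]
    refine Finset.sum_congr (by simp) fun j _ => ?_
    rw [add_comm]
  rw [h1]
  refine sum_roughCellDensity_eq_mul_buchstabOmega N hu ?_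
  have h2 := Nat.lt_floor_add_one u
  rw [hN] at h2
  push_cast at h2
  linarith

/-- `Σ_{r⃗ ∈ [1,⌊u⌋]^k} ∏ᵢ I_{rᵢ}(u) = (u ω(u))^k`: the model densities of the occupied cells add up
to the Buchstab shape of the crux (Buchstab's identity per coordinate, multiplied out). [folklore] -/
theorem sum_cellBox_modelDensity (k : ℕ) {u : ℝ} (hu : 1 ≤ u) :
    ∑ r ∈ cellBox k ⌊u⌋₊, modelDensity r u = (u * buchstabOmega u) ^ k := by
  unfold cellBox modelDensity
  rw [← sum_Icc_roughCellDensity hu, Finset.sum_pow']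

/-- The cells of the parity class `ε` at depth `3` have model densities adding up to `classWeight ε`:
per coordinate `Σ_{r ∈ {1,2,3}, r ≡ 0} I_r(3) = I₂(3) = log 2` and `Σ_{r ≡ 1} I_r(3) = I₁(3) + I₃(3) = 1`. [folklore] -/
theorem sum_parityBox_modelDensity {k : ℕ} (ε : Fin k → ℕ) (hε : ∀ i, ε i ≤ 1) :
    ∑ r ∈ parityBox ε, modelDensity r 3 = classWeight ε := by
  have hI1 : roughCellDensity 1 3 = 1 := roughCellDensity_one_of_one_le (by norm_num)
  have hI2 : roughCellDensity 2 3 = Real.log 2 := by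
    rw [roughCellDensity_two_of_two_le (by norm_num)]; norm_num
  have hI3 : roughCellDensity 3 3 = 0 :=
    roughCellDensity_of_le (j := 3) (by norm_num) (by norm_num)
  have key : ∀ i : Fin k, ∑ j ∈ (Icc 1 3).filter (fun r : ℕ => r % 2 = ε i), roughCellDensity j 3
      = (if ε i = 0 then Real.log 2 else 1) := by
    intro i
    rcases Nat.le_one_iff_eq_zero_or_eq_one.mp (hε i) with h0 | h1
    · have hf : (Icc 1 3).filter (fun r : ℕ => r % 2 = ε i) = {2} := by rw [h0]; decide
      rw [hf, h0, sum_singleton, if_pos rfl, hI2]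
    · have hf : (Icc 1 3).filter (fun r : ℕ => r % 2 = ε i) = {1, 3} := by rw [h1]; decide
      rw [hf, h1, sum_pair (by norm_num), if_neg one_ne_zero, hI1, hI3, add_zero]
  calc ∑ r ∈ parityBox ε, modelDensity r 3
      = ∏ i, ∑ j ∈ (Icc 1 3).filter (fun r : ℕ => r % 2 = ε i), roughCellDensity j 3 :=
        (Finset.prod_univ_sum (fun i => (Icc 1 3).filter (fun r : ℕ => r % 2 = ε i))
          (fun _ j => roughCellDensity j 3)).symm
    _ = classWeight ε := Finset.prod_congr rfl fun i _ => key i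

/-- `classWeight ε > 0`. [folklore] -/
theorem classWeight_pos {k : ℕ} (ε : Fin k → ℕ) : 0 < classWeight ε := by
  unfold classWeight
  refine Finset.prod_pos fun i _ => ?_
  split_ifs
  · exact Real.log_pos (by norm_num)
  · exact one_pos

/-! ### Glue (proved): the parity amplitudes agree -/

/-- The parity class `ε` at depth 3, normalised, is `B_ε(x)·classWeight ε + o(1)` (cell shapes summed
over `parityBox ε`). [folklore] -/
theorem tendsto_parityClassSum_sub {k : ℕ} (f : Fin k → ℤ[X]) (B : (Fin k → ℕ) → ℕ → ℝ)
    (hB : ∀ r : Fin k → ℕ, (∀ i, 1 ≤ r i) → ∀ u : ℝ, 2 < u →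
      Tendsto (fun x : ℕ => (cellCount f r u x : ℝ) * Real.log x ^ k / x
        - B (parityVec r) x * modelDensity r u) atTop (𝓝 0))
    (ε : Fin k → ℕ) (hε : ∀ i, ε i ≤ 1) :
    Tendsto (fun x : ℕ => (parityClassSum f ε x : ℝ) * Real.log x ^ k / x
      - B ε x * classWeight ε) atTop (𝓝 0) := by
  have hmem : ∀ r ∈ parityBox ε, (∀ i, 1 ≤ r i) ∧ parityVec r = ε := by
    intro r hr
    rw [parityBox, Fintype.mem_piFinset] at hr
    refine ⟨fun i => (mem_Icc.mp (mem_filter.mp (hr i)).1).1, funext fun i => (mem_filter.mp (hr i)).2⟩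
  have h := tendsto_sum_cells_sub_model f B hB (parityBox ε) (fun r hr => (hmem r hr).1)
    (show (2 : ℝ) < 3 by norm_num)
  have hsum : ∀ x : ℕ, ∑ r ∈ parityBox ε, B (parityVec r) x * modelDensity r 3
      = B ε x * classWeight ε := by
    intro x
    rw [← sum_parityBox_modelDensity ε hε, mul_sum]
    exact Finset.sum_congr rfl fun r hr => by rw [(hmem r hr).2]
  refine h.congr' (Eventually.of_forall fun x => ?_)
  rw [hsum x]
  simp only [parityClassSum, Nat.cast_sum]

/-- **The parity scalars**: given cell shapes with amplitudes `B` and the parity signature at depth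
`3`, all `2^k` amplitudes are asymptotically equal. [folklore] -/
theorem tendsto_amplitude_sub {k : ℕ} (f : Fin k → ℤ[X]) (B : (Fin k → ℕ) → ℕ → ℝ)
    (hB : ∀ r : Fin k → ℕ, (∀ i, 1 ≤ r i) → ∀ u : ℝ, 2 < u →
      Tendsto (fun x : ℕ => (cellCount f r u x : ℝ) * Real.log x ^ k / x
        - B (parityVec r) x * modelDensity r u) atTop (𝓝 0))
    (hP : ∀ ε ε' : Fin k → ℕ, (∀ i, ε i ≤ 1) → (∀ i, ε' i ≤ 1) →
      Tendsto (fun x : ℕ => ((parityClassSum f ε x : ℝ) * classWeight ε'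
        - (parityClassSum f ε' x : ℝ) * classWeight ε) * Real.log x ^ k / x) atTop (𝓝 0))
    (ε ε' : Fin k → ℕ) (hε : ∀ i, ε i ≤ 1) (hε' : ∀ i, ε' i ≤ 1) :
    Tendsto (fun x : ℕ => B ε x - B ε' x) atTop (𝓝 0) := by
  have hW0 : 0 < classWeight ε := classWeight_pos ε
  have hW0' : 0 < classWeight ε' := classWeight_pos ε'
  have hWW : classWeight ε * classWeight ε' ≠ 0 := (mul_pos hW0 hW0').ne'
  -- the two classes, normalised: c_ε(x) = B_ε(x) W_ε + o(1), c_ε'(x) = B_ε'(x) W_ε' + o(1)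
  have h1 : Tendsto (fun x : ℕ => (parityClassSum f ε x : ℝ) * Real.log x ^ k / x
      - B ε x * classWeight ε) atTop (𝓝 0) :=
    tendsto_parityClassSum_sub f B hB ε hε
  have h2 : Tendsto (fun x : ℕ => (parityClassSum f ε' x : ℝ) * Real.log x ^ k / x
      - B ε' x * classWeight ε') atTop (𝓝 0) :=
    tendsto_parityClassSum_sub f B hB ε' hε'
  -- the signature: c_ε W_ε' − c_ε' W_ε → 0
  have h3 : Tendsto (fun x : ℕ => (parityClassSum f ε x : ℝ) * Real.log x ^ k / x * classWeight ε'
      - (parityClassSum f ε' x : ℝ) * Real.log x ^ k / x * classWeight ε) atTop (𝓝 0) := by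
    refine (hP ε ε' hε hε').congr' (Eventually.of_forall fun x => ?_)
    ring
  -- (B ε − B ε') W W' = −(c − B ε W) W' + (c W' − c' W) + (c' − B ε' W') W
  have h4 : Tendsto (fun x : ℕ => (B ε x - B ε' x) * (classWeight ε * classWeight ε'))
      atTop (𝓝 0) := by
    have h := ((h1.neg.mul_const (classWeight ε')).add h3).add (h2.mul_const (classWeight ε))
    simp only [neg_zero, zero_mul, add_zero] at h
    refine h.congr' (Eventually.of_forall fun x => ?_)
    ring
  have h5 := h4.div_const (classWeight ε * classWeight ε')
  rw [zero_div] at h5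
  refine h5.congr' (Eventually.of_forall fun x => ?_)
  rw [mul_div_assoc, div_self hWW, mul_one]

/-! ### Glue (proved): the profile has Buchstab shape with amplitude `B₀` -/

/-- **Claim A.** Decomposition + cell shapes + parity scalars give
`Φ_f(x,u)(log x)^k/x − B₀(x)(uω(u))^k → 0` for every `u > 2`, with `B₀ = B_{(0,…,0)}`. [folklore] -/
theorem tendsto_roughCount_sub_amplitude {k : ℕ} (f : Fin k → ℤ[X])
    (hD : ∀ u : ℝ, 2 < u → ∃ K : ℝ, ∀ᶠ x : ℕ in atTop,
      |(roughCount f u x : ℝ) - ∑ r ∈ cellBox k ⌊u⌋₊, (cellCount f r u x : ℝ)| ≤ K)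
    (B : (Fin k → ℕ) → ℕ → ℝ)
    (hB : ∀ r : Fin k → ℕ, (∀ i, 1 ≤ r i) → ∀ u : ℝ, 2 < u →
      Tendsto (fun x : ℕ => (cellCount f r u x : ℝ) * Real.log x ^ k / x
        - B (parityVec r) x * modelDensity r u) atTop (𝓝 0))
    (hAmp : ∀ ε : Fin k → ℕ, (∀ i, ε i ≤ 1) →
      Tendsto (fun x : ℕ => B ε x - B (fun _ => 0) x) atTop (𝓝 0))
    {u : ℝ} (hu : 2 < u) :
    Tendsto (fun x : ℕ => (roughCount f u x : ℝ) * Real.log x ^ k / x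
      - B (fun _ => 0) x * (u * buchstabOmega u) ^ k) atTop (𝓝 0) := by
  obtain ⟨K, hK⟩ := hD u hu
  have hu1 : (1 : ℝ) ≤ u := by linarith
  -- L1: Φ ~ Σ cells
  have h1 := tendsto_roughCount_sub_sum_cells f u K hK
  -- L2: Σ cells ~ Σ B Π
  have hbox : ∀ r ∈ cellBox k ⌊u⌋₊, ∀ i, 1 ≤ r i := fun r hr i => by
    rw [cellBox, Fintype.mem_piFinset] at hr
    exact (mem_Icc.mp (hr i)).1
  have h2 := tendsto_sum_cells_sub_model f B hB (cellBox k ⌊u⌋₊) hbox hu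
  -- L4: Σ B Π − B₀ Σ Π → 0 (parity amplitudes agree), Σ Π = (uω)^k
  have hpar : ∀ r ∈ cellBox k ⌊u⌋₊, ∀ i, parityVec r i ≤ 1 := fun r _ i => by
    show r i % 2 ≤ 1
    omega
  have h3 : Tendsto (fun x : ℕ => ∑ r ∈ cellBox k ⌊u⌋₊, B (parityVec r) x * modelDensity r u
      - B (fun _ => 0) x * (u * buchstabOmega u) ^ k) atTop (𝓝 0) := by
    have h := tendsto_finsetSum (cellBox k ⌊u⌋₊)
      (fun r hr => (hAmp (parityVec r) (hpar r hr)).mul_const (modelDensity r u))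
    simp only [zero_mul, sum_const_zero] at h
    refine h.congr' (Eventually.of_forall fun x => ?_)
    dsimp only
    rw [← sum_cellBox_modelDensity k hu1, mul_sum, ← sum_sub_distrib]
    exact Finset.sum_congr rfl fun r _ => by ring
  have h := (h1.add h2).add h3
  simp only [add_zero] at h
  refine h.congr' (Eventually.of_forall fun x => ?_)
  ring

/-- **The conclusion of the crux at `ω = buchstabOmega`, system by system, from the four arithmetic
stubs** (hypothesis form). [folklore] -/
theorem tendsto_roughCount_of_parts {k : ℕ} (f : Fin k → ℤ[X])
    (hD : ∀ u : ℝ, 2 < u → ∃ K : ℝ, ∀ᶠ x : ℕ in atTop,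
      |(roughCount f u x : ℝ) - ∑ r ∈ cellBox k ⌊u⌋₊, (cellCount f r u x : ℝ)| ≤ K)
    (B : (Fin k → ℕ) → ℕ → ℝ)
    (hB : ∀ r : Fin k → ℕ, (∀ i, 1 ≤ r i) → ∀ u : ℝ, 2 < u →
      Tendsto (fun x : ℕ => (cellCount f r u x : ℝ) * Real.log x ^ k / x
        - B (parityVec r) x * modelDensity r u) atTop (𝓝 0))
    (hAmp : ∀ ε : Fin k → ℕ, (∀ i, ε i ≤ 1) →
      Tendsto (fun x : ℕ => B ε x - B (fun _ => 0) x) atTop (𝓝 0))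
    (hA : ∀ B₀ : ℕ → ℝ,
      (∀ u : ℝ, 2 < u → Tendsto (fun x : ℕ => (roughCount f u x : ℝ) * Real.log x ^ k / x
        - B₀ x * (u * buchstabOmega u) ^ k) atTop (𝓝 0)) →
      Tendsto B₀ atTop (𝓝 (bhAmplitude f)))
    {u : ℝ} (hu : 2 < u) :
    Tendsto (fun x : ℕ => (roughCount f u x : ℝ) * Real.log x ^ k / x) atTop
      (𝓝 (bhAmplitude f * (u * buchstabOmega u) ^ k)) := by
  have hclaim : ∀ v : ℝ, 2 < v → Tendsto (fun x : ℕ => (roughCount f v x : ℝ) * Real.log x ^ k / x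
      - B (fun _ => 0) x * (v * buchstabOmega v) ^ k) atTop (𝓝 0) :=
    fun v hv => tendsto_roughCount_sub_amplitude f hD B hB hAmp hv
  have hB0 : Tendsto (B fun _ => 0) atTop (𝓝 (bhAmplitude f)) := hA _ hclaim
  have h := (hclaim u hu).add (hB0.mul_const ((u * buchstabOmega u) ^ k))
  rw [zero_add] at h
  refine h.congr' (Eventually.of_forall fun x => ?_)
  ring

/-- **The all-prime cell** (honesty record, proved): under the four arithmetic stubs the cell
`r⃗ = (1,…,1)` — the `1 ≤ n ≤ x` all of whose values are (rough) PRIMES — satisfies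
`N_{f,1⃗}(x,u)(log x)^k/x → C(f)/∏ deg fᵢ` for every `u > 2`; since `N_{f,1⃗}(x,u) = P_f(x) − O(x^{1/u})`,
this is the Bateman–Horn asymptotic for `f`: the line decides the summit conjunct system by system,
not only the crux (triage r1-3 (iv), acknowledged). [folklore] -/
theorem primeCell_tendsto_of_parts {k : ℕ} (f : Fin k → ℤ[X])
    (hD : ∀ u : ℝ, 2 < u → ∃ K : ℝ, ∀ᶠ x : ℕ in atTop,
      |(roughCount f u x : ℝ) - ∑ r ∈ cellBox k ⌊u⌋₊, (cellCount f r u x : ℝ)| ≤ K)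
    (B : (Fin k → ℕ) → ℕ → ℝ)
    (hB : ∀ r : Fin k → ℕ, (∀ i, 1 ≤ r i) → ∀ u : ℝ, 2 < u →
      Tendsto (fun x : ℕ => (cellCount f r u x : ℝ) * Real.log x ^ k / x
        - B (parityVec r) x * modelDensity r u) atTop (𝓝 0))
    (hAmp : ∀ ε : Fin k → ℕ, (∀ i, ε i ≤ 1) →
      Tendsto (fun x : ℕ => B ε x - B (fun _ => 0) x) atTop (𝓝 0))
    (hA : ∀ B₀ : ℕ → ℝ,
      (∀ u : ℝ, 2 < u → Tendsto (fun x : ℕ => (roughCount f u x : ℝ) * Real.log x ^ k / x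
        - B₀ x * (u * buchstabOmega u) ^ k) atTop (𝓝 0)) →
      Tendsto B₀ atTop (𝓝 (bhAmplitude f)))
    {u : ℝ} (hu : 2 < u) :
    Tendsto (fun x : ℕ => (cellCount f (fun _ => 1) u x : ℝ) * Real.log x ^ k / x) atTop
      (𝓝 (bhAmplitude f)) := by
  have hclaim : ∀ v : ℝ, 2 < v → Tendsto (fun x : ℕ => (roughCount f v x : ℝ) * Real.log x ^ k / x
      - B (fun _ => 0) x * (v * buchstabOmega v) ^ k) atTop (𝓝 0) :=
    fun v hv => tendsto_roughCount_sub_amplitude f hD B hB hAmp hv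
  have hB0 : Tendsto (B fun _ => 0) atTop (𝓝 (bhAmplitude f)) := hA _ hclaim
  have hB1 : Tendsto (B fun _ => 1) atTop (𝓝 (bhAmplitude f)) := by
    have h := (hAmp (fun _ => 1) (fun _ => le_rfl)).add hB0
    rw [zero_add] at h
    exact h.congr' (Eventually.of_forall fun x => by ring)
  have hcell := hB (fun _ => 1) (fun _ => le_rfl) u hu
  have hpv : parityVec (fun _ : Fin k => 1) = fun _ => 1 := funext fun _ => rfl
  have hmd : modelDensity (fun _ : Fin k => 1) u = 1 := by
    unfold modelDensity
    exact Finset.prod_eq_one fun i _ => roughCellDensity_one_of_one_le (by linarith)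
  rw [hpv, hmd] at hcell
  have h := hcell.add hB1
  rw [zero_add] at h
  refine h.congr' (Eventually.of_forall fun x => ?_)
  ring

/-! ### Reshape c1 (proved): the two open stubs from their linear sector + general sector -/

/-- **Cell shapes for every system** (the statement of the former `stub_cellShape`), from
`stub_linearCells` (linear sector, constant amplitude `bhAmplitude f`), `stub_cellShapeGeneral` (non-thin cells)
and `stub_thinCells` (thin cells, any amplitude). [folklore] -/
theorem cellShape_of_stubs :
    ∀ (k : ℕ) (f : Fin k → ℤ[X]), IsBatemanHornSystem f →
      ∃ B : (Fin k → ℕ) → ℕ → ℝ, ∀ r : Fin k → ℕ, (∀ i, 1 ≤ r i) → ∀ u : ℝ, 2 < u →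
        Tendsto (fun x : ℕ => (cellCount f r u x : ℝ) * Real.log x ^ k / x
          - B (parityVec r) x * modelDensity r u) atTop (𝓝 0) := by
  intro k f hf
  rcases em (k = 1 ∧ ∀ i, (f i).natDegree = 1) with ⟨rfl, hd⟩ | hgen
  · exact ⟨fun _ _ => bhAmplitude f, fun r hr u hu => linearCells_of_stub f hf (hd 0) r hr u hu⟩
  · obtain ⟨B, hB⟩ := cellShapeGeneral_of_stub k f hf hgen
    refine ⟨B, fun r hr u hu => ?_⟩
    by_cases hover : ∃ i, u < (r i : ℝ)
    · exact thinCells_of_stub k f hf B r u hu (Or.inl hover)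
    · by_cases hmon : ∃ i, (f i).Monic ∧ u ≤ (r i : ℝ)
      · exact thinCells_of_stub k f hf B r u hu (Or.inr hmon)
      · push Not at hover hmon
        exact hB r hr u hu hover hmon

/-- **Parity signature for every system** (the statement of the former `stub_paritySignature`), from
`stub_linearCells` (linear sector: every parity class is `bhAmplitude f · classWeight ε + o(1)`, so the
cross-multiplied differences vanish in the limit) and `stub_paritySignatureGeneral`. [folklore] -/
theorem paritySignature_of_stubs :
    ∀ (k : ℕ) (f : Fin k → ℤ[X]), IsBatemanHornSystem f →
      ∀ ε ε' : Fin k → ℕ, (∀ i, ε i ≤ 1) → (∀ i, ε' i ≤ 1) →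
        Tendsto (fun x : ℕ => ((parityClassSum f ε x : ℝ) * classWeight ε'
          - (parityClassSum f ε' x : ℝ) * classWeight ε) * Real.log x ^ k / x) atTop (𝓝 0) := by
  intro k f hf ε ε' hε hε'
  rcases em (k = 1 ∧ ∀ i, (f i).natDegree = 1) with ⟨rfl, hd⟩ | hgen
  · set B : (Fin 1 → ℕ) → ℕ → ℝ := fun _ _ => bhAmplitude f with hB_def
    have hB : ∀ r : Fin 1 → ℕ, (∀ i, 1 ≤ r i) → ∀ u : ℝ, 2 < u →
        Tendsto (fun x : ℕ => (cellCount f r u x : ℝ) * Real.log x ^ 1 / x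
          - B (parityVec r) x * modelDensity r u) atTop (𝓝 0) :=
      fun r hr u hu => linearCells_of_stub f hf (hd 0) r hr u hu
    have h1 := tendsto_parityClassSum_sub f B hB ε hε
    have h2 := tendsto_parityClassSum_sub f B hB ε' hε'
    have h := (h1.mul_const (classWeight ε')).sub (h2.mul_const (classWeight ε))
    simp only [zero_mul, sub_zero] at h
    refine h.congr' (Eventually.of_forall fun x => ?_)
    simp only [hB_def]
    ring
  · exact paritySignatureGeneral_of_stub k f hf hgen ε ε' hε hε'

/-! ### The composition: the stubs imply the crux BY NAME -/

/-- **The crux's statement from the five stub STATEMENTS** (hypothesis form; real proof, no `sorry`,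
axioms ⊆ {propext, Classical.choice, Quot.sound}).  The conclusion is the crux's body verbatim (so
that the by-name audit sees exactly one theorem concluding `RoughValueLaw`, the next one).  Proof:
fix a system; `stub_cellShape` gives the amplitudes `B`; `tendsto_amplitude_sub` (parity signature)
makes them asymptotically equal; `tendsto_roughCount_of_parts` gives the conclusion at
`ω = buchstabOmega` with `A = C(f)/∏ deg fᵢ`; `stub_buchstabUnique` transports it to every `ω`
satisfying the inline predicate. [folklore] -/
theorem roughValueLaw_of_parts
    (hD : ∀ (k : ℕ) (f : Fin k → ℤ[X]), IsBatemanHornSystem f → ∀ u : ℝ, 2 < u →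
      ∃ K : ℝ, ∀ᶠ x : ℕ in atTop,
        |(roughCount f u x : ℝ) - ∑ r ∈ cellBox k ⌊u⌋₊, (cellCount f r u x : ℝ)| ≤ K)
    (hS : ∀ (k : ℕ) (f : Fin k → ℤ[X]), IsBatemanHornSystem f →
      ∃ B : (Fin k → ℕ) → ℕ → ℝ, ∀ r : Fin k → ℕ, (∀ i, 1 ≤ r i) → ∀ u : ℝ, 2 < u →
        Tendsto (fun x : ℕ => (cellCount f r u x : ℝ) * Real.log x ^ k / x
          - B (parityVec r) x * modelDensity r u) atTop (𝓝 0))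
    (hP : ∀ (k : ℕ) (f : Fin k → ℤ[X]), IsBatemanHornSystem f →
      ∀ ε ε' : Fin k → ℕ, (∀ i, ε i ≤ 1) → (∀ i, ε' i ≤ 1) →
        Tendsto (fun x : ℕ => ((parityClassSum f ε x : ℝ) * classWeight ε'
          - (parityClassSum f ε' x : ℝ) * classWeight ε) * Real.log x ^ k / x) atTop (𝓝 0))
    (hA : ∀ (k : ℕ) (f : Fin k → ℤ[X]), IsBatemanHornSystem f → ∀ B₀ : ℕ → ℝ,
      (∀ u : ℝ, 2 < u → Tendsto (fun x : ℕ => (roughCount f u x : ℝ) * Real.log x ^ k / x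
        - B₀ x * (u * buchstabOmega u) ^ k) atTop (𝓝 0)) →
      Tendsto B₀ atTop (𝓝 (bhAmplitude f)))
    (hU : ∀ ω : ℝ → ℝ, ((∀ u : ℝ, 1 ≤ u → u ≤ 2 → ω u = u⁻¹) ∧ ContinuousOn ω (Set.Ici 1) ∧
      (∀ u : ℝ, 2 < u → HasDerivAt (fun t : ℝ => t * ω t) (ω (u - 1)) u)) →
      ∀ u : ℝ, 2 < u → ω u = buchstabOmega u) :
    ∀ (k : ℕ) (f : Fin k → Polynomial ℤ), Literature.NumberTheory.Sieve.IsBatemanHornSystem f →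
      ∀ ω : ℝ → ℝ, ((∀ u : ℝ, 1 ≤ u → u ≤ 2 → ω u = u⁻¹) ∧ ContinuousOn ω (Set.Ici 1) ∧
        (∀ u : ℝ, 2 < u → HasDerivAt (fun t : ℝ => t * ω t) (ω (u - 1)) u)) →
      ∃ A : ℝ, ∀ u : ℝ, 2 < u → Filter.Tendsto (fun x : ℕ =>
        (((Finset.Icc 1 x).filter (fun n : ℕ => ∀ i, 0 < (f i).eval (n : ℤ) ∧
          ∀ p ∈ Finset.range ⌈(x : ℝ) ^ (((f i).natDegree : ℝ) / u)⌉₊,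
            p.Prime → ¬ ((p : ℤ) ∣ (f i).eval (n : ℤ)))).card : ℝ) * Real.log x ^ k / (x : ℝ))
        Filter.atTop (nhds (A * (u * ω u) ^ k)) := by
  intro k f hf ω hω
  obtain ⟨B, hB⟩ := hS k f hf
  have hAmp : ∀ ε : Fin k → ℕ, (∀ i, ε i ≤ 1) →
      Tendsto (fun x : ℕ => B ε x - B (fun _ => 0) x) atTop (𝓝 0) :=
    fun ε hε => tendsto_amplitude_sub f B hB (hP k f hf) ε (fun _ => 0) hε (fun _ => zero_le_one)
  refine ⟨bhAmplitude f, fun u hu => ?_⟩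
  rw [hU ω hω u hu]
  exact tendsto_roughCount_of_parts f (hD k f hf) B hB hAmp (hA k f hf) hu

/-- **The line concludes the crux BY NAME** (the `#h21_check_skeleton` theorem): the five registered
stubs, fed to `roughValueLaw_of_parts`, give
`Summit.Parity.BatemanHorn.Theses.RoughValueTransport.RoughValueLaw`.  No `sorry` of its own; its
axiom closure contains `sorryAx` exactly through the `stub_*`. -/
theorem RoughValueLaw_of : RoughValueLaw :=
  roughValueLaw_of_parts roughDecomposition_of_stub cellShape_of_stubs paritySignature_of_stubs
    amplitudeAnchor_of_stub stub_buchstabUnique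

end Summit.Parity.BatemanHorn.Cruxes.RoughValueLaw.OmegaClassShapeSplit
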